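import Literature.NumberTheory.PAdicHodge.TateGradedFiltration
import HarnessLib

/-!
# Tate-graded period rings, II: injectivity of the comparison map on graded pieces

Topic `Literature/NumberTheory/PAdicHodge`; namespace `Literature.NumberTheory.PAdicHodge.TateGraded`.
THEOREMS ONLY (no definition, no named fact, no instance, no `sorry`); sequel to `TateGradedFiltration`
(hypotheses `hU`, `hχ`, `hχ0`, `hloc`, `hT0`, `hT1` on an abstract `PeriodRingData` — see that file's
docstring; all hold for `B_dR(F)`). Source formalised: N. Wach, *Représentations p-adiques potentiellement
cristallines*, Bull. SMF 124 (1996) §B.2.3, proof of Prop. 2 (p. 394): for a de Rham `V` and a basis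
`(u_i)` of `D_dR(V)` adapted to the filtration (`r_i` maximal with `u_i ∈ Fil^{r_i}`), « `Hom_{ℚ_p}(V, B_dR⁺)`
est le `B_dR⁺`-module libre de base les `t^{-r_i} u_i` » — whose graded-piece content is the statement
below (read for `V` in place of `V^*`).

## Main result (`mem_fil_succ_of_sum_smul_mem_filTensor`)

Let `e_k ∈ D_B(V)` (`k ∈ ι` finite) be `Γ`-invariant vectors of `B ⊗_P V` with weights `w_k`, `e_k ∈
Fil^{w_k}(B ⊗ V)`, ADAPTED: an `E`-combination of the `e_k` of one weight `i` lying in `Fil^{i+1}(B ⊗ V)` is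
trivial. If `c_k ∈ Fil^{n − w_k} B` and `Σ_k c_k e_k ∈ Fil^{n+1}(B ⊗ V)`, then `c_k ∈ Fil^{n+1−w_k} B` for all
`k`. Proof (`core_aux`, Fontaine's semilinear independence argument on `gr^n`, by induction on the number
of coefficients that are units of `Fil⁰`): normalise one unit coefficient to `U^m` (`hloc`), apply
`σ − χ(σ)^m` to kill it modulo `Fil^{m+1}` (`hχ`), conclude by induction that the other leading coefficients
satisfy `σ b ≡ χ(σ)^{w_k − w_{k₀}} b (mod Fil¹)`, hence vanish off the weight `w_{k₀}` (`hT1`) and are scalars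
`a_k ∈ E` on it (`hT0`); then `Σ a_k e_k ∈ Fil^{w_{k₀}+1}(B ⊗ V)` contradicts adaptedness.

## References
* N. Wach, Bull. Soc. Math. France 124 (1996), §B.2.3, Prop. 2 and proof (p. 394). [Wach1996]
* J.-M. Fontaine, *Représentations p-adiques semi-stables*, Astérisque 223 (1994), Exp. III, Thm. 1.5.2
  (comparison isomorphism for admissible `V`), §1.5.4 (induced filtration). [FontaineAsterisque223III]
* L. Berger, *An introduction to the theory of p-adic representations* (2004), §II "p-adic Hodge theory",
  "Construction of B_dR": `Gr B_dR ≃ ⊕ ℂ_p(i)`; de Rham ⇒ Hodge–Tate. [Berger2004Intro]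
-/

noncomputable section

open scoped TensorProduct
open TensorProduct

namespace Literature.NumberTheory.PAdicHodge.TateGraded

open Literature.NumberTheory.GaloisRepresentations
open Literature.NumberTheory.GaloisRepresentations.PeriodRingData

-- Mathlib's own global value; needed for instance problems on `𝔅.B ⊗[P] M` (see `PAdicHodgeProofs`).
set_option maxSynthPendingDepth 3

universe u v v' w w'

variable {Γ : Type u} [Group Γ] {P : Type v} {E : Type v'} [Field P] [Field E] [Algebra P E]
  {M : Type w'} [AddCommGroup M] [Module P M]
  (𝔅 : PeriodRingData.{u, v, v', w} Γ P E) {U : 𝔅.B} {χ : Γ → E}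

/-! ## §3 The graded injectivity -/

section Core

variable [TopologicalSpace Γ] [TopologicalSpace P] [TopologicalSpace M] (ρ : ContinuousRep Γ P M)
  {ι : Type*} [Fintype ι] [DecidableEq ι]
  (hU : ∀ (i : ℤ) (x : 𝔅.B), x ∈ 𝔅.fil (i + 1) ↔ ∃ y ∈ 𝔅.fil i, x = U * y)
  (hχ : ∀ σ : Γ, ∃ k ∈ 𝔅.fil 0, σ • U = k * U ∧ k - algebraMap E 𝔅.B (χ σ) ∈ 𝔅.fil 1)
  (hχ0 : ∀ σ : Γ, χ σ ≠ 0)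
  (hloc : ∀ b ∈ 𝔅.fil 0, b ∉ 𝔅.fil 1 → ∃ b' ∈ 𝔅.fil 0, b * b' = 1)
  (hT0 : ∀ b ∈ 𝔅.fil 0, (∀ σ : Γ, σ • b - b ∈ 𝔅.fil 1) → ∃ e : E, b - algebraMap E 𝔅.B e ∈ 𝔅.fil 1)
  (hT1 : ∀ (j : ℤ), j ≠ 0 → ∀ b ∈ 𝔅.fil 0,
    (∀ σ : Γ, σ • b - algebraMap E 𝔅.B (χ σ ^ j) * b ∈ 𝔅.fil 1) → b ∈ 𝔅.fil 1)
  {e : ι → 𝔅.B ⊗[P] M} (heD : ∀ k, e k ∈ 𝔅.D ρ) {w : ι → ℤ}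
  (hew : ∀ k, e k ∈ 𝔅.filTensor M (w k))
  (hadapt : ∀ (i : ℤ) (a : ι → E), (∀ k, a k ≠ 0 → w k = i) →
    (∑ k, algebraMap E 𝔅.B (a k) • e k) ∈ 𝔅.filTensor M (i + 1) → ∀ k, a k = 0)

include hU in
omit [TopologicalSpace Γ] [TopologicalSpace P] [TopologicalSpace M] [Fintype ι] [DecidableEq ι] in
/-- `Fil¹ · Fil⁰ ⊆ Fil¹` and the congruence `k^m ≡ a^m (mod Fil¹)` for `k ≡ a`: if `k, a ∈ Fil⁰` and
`k − a ∈ Fil¹` then `k^m x − a^m x ∈ Fil¹` for every `x ∈ Fil⁰` (used with `k = σ(t)/t`, `a = χ(σ)`).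
[cite: FontaineAsterisque223III, Exp. II §1.5.5 (σ(t) = χ(σ) t modulo Fil²)] -/
theorem pow_mul_sub_pow_mul_mem_fil_one {k a x : 𝔅.B} (hk : k ∈ 𝔅.fil 0) (ha : a ∈ 𝔅.fil 0)
    (hka : k - a ∈ 𝔅.fil 1) (hx : x ∈ 𝔅.fil 0) (m : ℕ) : k ^ m * x - a ^ m * x ∈ 𝔅.fil 1 := by
  have _ := hU
  rw [← sub_mul, ← geom_sum₂_mul]
  have h1 : (∑ i ∈ Finset.range m, k ^ i * a ^ (m - 1 - i)) * (k - a) ∈ 𝔅.fil 1 := by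
    simpa using 𝔅.mul_mem_fil 0 1 _ _ (Submodule.sum_mem _ fun i _ =>
      mul_mem_fil_zero 𝔅 (pow_mem_fil_zero 𝔅 hk i) (pow_mem_fil_zero 𝔅 ha _)) hka
  simpa using 𝔅.mul_mem_fil 1 0 _ _ h1 hx

include hU hχ hχ0 hloc hT0 hT1 heD hew hadapt in
/-- **The graded injectivity, normalised form** (induction on the number `s` of unit coefficients).
With `(m k : ℤ) + w k = n`: if `b k ∈ Fil⁰` and `Σ_k U^{m k} b_k · e_k ∈ Fil^{n+1}(B ⊗ V)`, then every
`b k ∈ Fil¹`. [cite: Wach1996, §B.2.3, proof of Prop. 2 (p. 394)] [cite: FontaineAsterisque223III, Exp. III Thm. 1.5.2] -/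
theorem core_aux [Module.Finite P M] (n : ℤ) (m : ι → ℕ) (hm : ∀ k, (m k : ℤ) + w k = n) :
    ∀ (s : ℕ) (b : ι → 𝔅.B) (S : Finset ι), (∀ k, b k ∈ 𝔅.fil 0) → (∀ k, k ∉ S → b k ∈ 𝔅.fil 1) →
      (∑ k, (U ^ m k * b k) • e k) ∈ 𝔅.filTensor M (n + 1) → S.card ≤ s → ∀ k, b k ∈ 𝔅.fil 1 := by
  intro s
  induction s with
  | zero =>
    intro b S _ hS _ hcard k
    exact hS k (by rw [Finset.card_eq_zero.1 (Nat.le_zero.1 hcard)]; exact Finset.notMem_empty k)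
  | succ s ih =>
    intro b S hb0 hS hsum hcard
    by_contra hnot
    obtain ⟨k₀, hk₀⟩ := not_forall.1 hnot
    have hk₀S : k₀ ∈ S := by
      by_contra h
      exact hk₀ (hS k₀ h)
    -- (N) normalise the `k₀`-th coefficient to `U ^ m k₀`
    obtain ⟨b₀', hb₀'0, hb₀'⟩ := hloc (b k₀) (hb0 k₀) hk₀
    set b' : ι → 𝔅.B := fun k => b k * b₀' with hb'
    have hb'0 : ∀ k, b' k ∈ 𝔅.fil 0 := fun k => mul_mem_fil_zero 𝔅 (hb0 k) hb₀'0
    have hb'k₀ : b' k₀ = 1 := hb₀'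
    have hb'S : ∀ k, k ∉ S → b' k ∈ 𝔅.fil 1 := fun k hk => by
      simpa using 𝔅.mul_mem_fil 1 0 _ _ (hS k hk) hb₀'0
    have hk₀' : b' k₀ ∉ 𝔅.fil 1 := by
      intro h
      have hbk : b k₀ = b' k₀ * b k₀ := by rw [hb'k₀, one_mul]
      exact hk₀ (by rw [hbk]; simpa using 𝔅.mul_mem_fil 1 0 _ _ h (hb0 k₀))
    have hsum' : (∑ k, (U ^ m k * b' k) • e k) ∈ 𝔅.filTensor M (n + 1) := by
      have heq : (∑ k, (U ^ m k * b' k) • e k) = b₀' • ∑ k, (U ^ m k * b k) • e k := by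
        rw [Finset.smul_sum]
        refine Finset.sum_congr rfl fun k _ => ?_
        rw [smul_smul]
        congr 1
        simp only [hb']
        ring
      rw [heq]
      exact smul_mem_filTensor_of_mem_fil_zero 𝔅 hb₀'0 hsum
    -- (T) twist by `σ`: the system `k_σ^{m k} σ(b'_k) − χ(σ)^{m k₀} b'_k` has fewer units; induct
    have key : ∀ (σ : Γ) (k : ι), ∃ kσ ∈ 𝔅.fil 0, kσ - algebraMap E 𝔅.B (χ σ) ∈ 𝔅.fil 1 ∧
        kσ ^ m k * (σ • b' k) - algebraMap E 𝔅.B (χ σ ^ m k₀) * b' k ∈ 𝔅.fil 1 := by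
      intro σ
      obtain ⟨kσ, hkσ0, hσU, hkσ1⟩ := hχ σ
      set bσ : ι → 𝔅.B := fun k =>
        kσ ^ m k * (σ • b' k) - algebraMap E 𝔅.B (χ σ ^ m k₀) * b' k with hbσ
      have hbσ0 : ∀ k, bσ k ∈ 𝔅.fil 0 := fun k =>
        Submodule.sub_mem _ (mul_mem_fil_zero 𝔅 (pow_mem_fil_zero 𝔅 hkσ0 _) (𝔅.smul_mem_fil σ 0 _ (hb'0 k)))
          (mul_mem_fil_zero 𝔅 (algebraMap_mem_fil_zero 𝔅 _) (hb'0 k))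
      have hx'σ : 𝔅.tensorRep ρ σ (∑ k, (U ^ m k * b' k) • e k) =
          ∑ k, (U ^ m k * (kσ ^ m k * σ • b' k)) • e k := by
        rw [𝔅.tensorRep_sum_smul_of_mem_D ρ Finset.univ e heD]
        refine Finset.sum_congr rfl fun k _ => ?_
        rw [smul_mul', smul_pow', hσU, mul_pow]
        ring_nf
      have hbσsum : (∑ k, (U ^ m k * bσ k) • e k) ∈ 𝔅.filTensor M (n + 1) := by
        have heq : (∑ k, (U ^ m k * bσ k) • e k) =
            𝔅.tensorRep ρ σ (∑ k, (U ^ m k * b' k) • e k) -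
              (χ σ ^ m k₀) • ∑ k, (U ^ m k * b' k) • e k := by
          rw [hx'σ, Finset.smul_sum, ← Finset.sum_sub_distrib]
          refine Finset.sum_congr rfl fun k _ => ?_
          rw [← algebraMap_smul 𝔅.B (χ σ ^ m k₀), smul_smul, ← sub_smul]
          congr 1
          simp only [hbσ]
          ring
        rw [heq]
        exact Submodule.sub_mem _ (tensorRep_mem_filTensor 𝔅 ρ σ hsum') (Submodule.smul_mem _ _ hsum')
      have hbσk₀ : bσ k₀ ∈ 𝔅.fil 1 := by
        have h := pow_mul_sub_pow_mul_mem_fil_one 𝔅 hU hkσ0 (algebraMap_mem_fil_zero 𝔅 (χ σ)) hkσ1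
          𝔅.one_mem_fil_zero (m k₀)
        simp only [hbσ, hb'k₀, smul_one, map_pow]
        simpa only [mul_one] using h
      have hbσgood : ∀ k, b' k ∈ 𝔅.fil 1 → bσ k ∈ 𝔅.fil 1 := fun k hk =>
        Submodule.sub_mem _
          (mul_mem_fil_of_mem_fil_zero 𝔅 1 (pow_mem_fil_zero 𝔅 hkσ0 _) (𝔅.smul_mem_fil σ 1 _ hk))
          (mul_mem_fil_of_mem_fil_zero 𝔅 1 (algebraMap_mem_fil_zero 𝔅 _) hk)
      have hbσS : ∀ k, k ∉ S.erase k₀ → bσ k ∈ 𝔅.fil 1 := by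
        intro k hk
        rw [Finset.mem_erase, not_and_or, not_not] at hk
        rcases hk with rfl | hk
        · exact hbσk₀
        · exact hbσgood k (hb'S k hk)
      have hcardσ : (S.erase k₀).card ≤ s := by
        rw [Finset.card_erase_of_mem hk₀S]
        omega
      have hIH := ih bσ (S.erase k₀) hbσ0 hbσS hbσsum hcardσ
      exact fun k => ⟨kσ, hkσ0, hkσ1, hIH k⟩
    -- (E) extract: `σ(b'_k) ≡ χ(σ)^{w k − w k₀} b'_k (mod Fil¹)`
    have keyE : ∀ (σ : Γ) (k : ι),
        σ • b' k - algebraMap E 𝔅.B (χ σ ^ (w k - w k₀)) * b' k ∈ 𝔅.fil 1 := by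
      intro σ k
      obtain ⟨kσ, hkσ0, hkσ1, hk⟩ := key σ k
      have h1 : kσ ^ m k * (σ • b' k) - algebraMap E 𝔅.B (χ σ) ^ m k * (σ • b' k) ∈ 𝔅.fil 1 :=
        pow_mul_sub_pow_mul_mem_fil_one 𝔅 hU hkσ0 (algebraMap_mem_fil_zero 𝔅 (χ σ)) hkσ1
          (𝔅.smul_mem_fil σ 0 _ (hb'0 k)) (m k)
      have h2 : algebraMap E 𝔅.B (χ σ) ^ m k * (σ • b' k) -
          algebraMap E 𝔅.B (χ σ ^ m k₀) * b' k ∈ 𝔅.fil 1 := by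
        have h := Submodule.sub_mem _ hk h1
        convert h using 1
        ring
      have h3 := Submodule.smul_mem _ ((χ σ ^ m k)⁻¹) h2
      have hexp : w k - w k₀ = (m k₀ : ℤ) - m k := by
        have := hm k; have := hm k₀; omega
      have hne : χ σ ^ m k ≠ 0 := pow_ne_zero _ (hχ0 σ)
      rw [smul_sub, Algebra.smul_def, Algebra.smul_def, ← map_pow, ← mul_assoc, ← map_mul,
        inv_mul_cancel₀ hne, map_one, one_mul, ← mul_assoc, ← map_mul] at h3
      rw [hexp, zpow_sub₀ (hχ0 σ), zpow_natCast, zpow_natCast, div_eq_mul_inv, mul_comm (χ σ ^ m k₀)]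
      exact h3
    -- (C) the leading coefficients are scalars on the weight of `k₀` and vanish elsewhere
    have hAk : ∀ k, w k = w k₀ → ∃ a : E, b' k - algebraMap E 𝔅.B a ∈ 𝔅.fil 1 := by
      intro k hwk
      refine hT0 (b' k) (hb'0 k) fun σ => ?_
      have h := keyE σ k
      rwa [hwk, sub_self, zpow_zero, map_one, one_mul] at h
    have hoff : ∀ k, w k ≠ w k₀ → b' k ∈ 𝔅.fil 1 := fun k hwk =>
      hT1 (w k - w k₀) (sub_ne_zero.2 hwk) (b' k) (hb'0 k) fun σ => keyE σ k
    let a : ι → E := fun k => if h : w k = w k₀ then Classical.choose (hAk k h) else 0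
    have ha_spec : ∀ k (h : w k = w k₀), b' k - algebraMap E 𝔅.B (a k) ∈ 𝔅.fil 1 := by
      intro k h
      simp only [a, dif_pos h]
      exact Classical.choose_spec (hAk k h)
    have ha_off : ∀ k, w k ≠ w k₀ → a k = 0 := fun k h => by simp only [a, dif_neg h]
    have hak₀ : a k₀ ≠ 0 := by
      intro h0
      have h := ha_spec k₀ rfl
      rw [h0, map_zero, sub_zero] at h
      exact hk₀' h
    have hmk : ∀ k, w k = w k₀ → m k = m k₀ := fun k h => by
      have := hm k; have := hm k₀; omega
    -- `U^{m k₀} · Σ a_k e_k ∈ Fil^{n+1}(B ⊗ V)`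
    have hy : (U ^ m k₀) • (∑ k, algebraMap E 𝔅.B (a k) • e k) ∈ 𝔅.filTensor M (n + 1) := by
      have hdiff : (U ^ m k₀) • (∑ k, algebraMap E 𝔅.B (a k) • e k) -
          ∑ k, (U ^ m k * b' k) • e k ∈ 𝔅.filTensor M (n + 1) := by
        rw [Finset.smul_sum, ← Finset.sum_sub_distrib]
        refine Submodule.sum_mem _ fun k _ => ?_
        rw [smul_smul, ← sub_smul]
        by_cases hwk : w k = w k₀
        · rw [hmk k hwk, ← mul_sub]
          have h1 : U ^ m k₀ * (algebraMap E 𝔅.B (a k) - b' k) ∈ 𝔅.fil (1 + m k₀) := by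
            refine pow_mul_mem_fil 𝔅 hU (m k₀) ?_
            have h := Submodule.neg_mem _ (ha_spec k hwk)
            rwa [neg_sub] at h
          have h2 := smul_mem_filTensor 𝔅 h1 (hew k)
          have hidx : (1 : ℤ) + (m k₀ : ℕ) + w k = n + 1 := by rw [hwk]; have := hm k₀; omega
          rwa [hidx] at h2
        · rw [ha_off k hwk, map_zero, mul_zero, zero_sub, neg_smul]
          refine Submodule.neg_mem _ ?_
          have h1 : U ^ m k * b' k ∈ 𝔅.fil (1 + m k) := pow_mul_mem_fil 𝔅 hU (m k) (hoff k hwk)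
          have h2 := smul_mem_filTensor 𝔅 h1 (hew k)
          have hidx : (1 : ℤ) + (m k : ℕ) + w k = n + 1 := by have := hm k; omega
          rwa [hidx] at h2
      have h := Submodule.add_mem _ hdiff hsum'
      rwa [sub_add_cancel] at h
    have hy' : (∑ k, algebraMap E 𝔅.B (a k) • e k) ∈ 𝔅.filTensor M (w k₀ + 1) := by
      refine mem_filTensor_of_pow_smul_mem 𝔅 hU (m k₀) ?_
      have hidx : w k₀ + 1 + (m k₀ : ℕ) = n + 1 := by have := hm k₀; omega
      rwa [hidx]
    exact hak₀ (hadapt (w k₀) a (fun k hk => by by_contra h; exact hk (ha_off k h)) hy' k₀)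

include hU hχ hχ0 hloc hT0 hT1 heD hew hadapt in
/-- **Graded injectivity of the comparison** (`gr^n` of `⊕_k Fil^{n − w_k} B · e_k → Fil^n(B ⊗ V)` is
injective): for `Γ`-invariant vectors `e_k ∈ D_B(V)` of weights `w_k`, adapted, and coefficients
`c_k ∈ Fil^{n − w_k} B` with `Σ_k c_k e_k ∈ Fil^{n+1}(B ⊗ V)`, every `c_k ∈ Fil^{n+1−w_k} B` — the
`Tate-graded` abstraction of « `Hom_{ℚ_p}(V, B_dR⁺)` est le `B_dR⁺`-module libre de base les `t^{-r_i} u_i` »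
on graded pieces. [cite: Wach1996, §B.2.3, proof of Prop. 2 (p. 394)] [cite: FontaineAsterisque223III, Exp. III Thm. 1.5.2] -/
theorem mem_fil_succ_of_sum_smul_mem_filTensor [Module.Finite P M] (n : ℤ) (c : ι → 𝔅.B)
    (hc : ∀ k, c k ∈ 𝔅.fil (n - w k)) (hsum : (∑ k, c k • e k) ∈ 𝔅.filTensor M (n + 1)) :
    ∀ k, c k ∈ 𝔅.fil (n + 1 - w k) := by
  -- shift so that all exponents `n + N − w k` are natural numbers
  obtain ⟨N, hN⟩ : ∃ N : ℕ, ∀ k, w k ≤ n + N := by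
    obtain ⟨B, hB⟩ := Finset.bddAbove (Finset.univ.image fun k => w k - n)
    refine ⟨B.toNat, fun k => ?_⟩
    have h := hB (Finset.mem_coe.2 (Finset.mem_image_of_mem _ (Finset.mem_univ k)))
    have := Int.self_le_toNat B
    omega
  set m : ι → ℕ := fun k => (n + N - w k).toNat with hmdef
  have hm : ∀ k, (m k : ℤ) + w k = n + N := fun k => by
    simp only [hmdef]
    rw [Int.toNat_of_nonneg (by have := hN k; omega)]
    ring
  -- `U^N c_k = U^{m k} b_k` with `b_k ∈ Fil⁰`
  have hb : ∀ k, ∃ b ∈ 𝔅.fil 0, U ^ N * c k = U ^ m k * b := by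
    intro k
    have h1 : U ^ N * c k ∈ 𝔅.fil ((0 : ℤ) + (m k : ℕ)) := by
      have h := pow_mul_mem_fil 𝔅 hU N (hc k)
      have hidx : n - w k + (N : ℕ) = (0 : ℤ) + (m k : ℕ) := by have := hm k; omega
      rwa [hidx] at h
    exact (mem_fil_add_iff 𝔅 hU 0 (m k) _).1 h1
  choose b hb0 hbeq using hb
  have hsum' : (∑ k, (U ^ m k * b k) • e k) ∈ 𝔅.filTensor M (n + N + 1) := by
    have heq : (∑ k, (U ^ m k * b k) • e k) = (U ^ N) • ∑ k, c k • e k := by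
      rw [Finset.smul_sum]
      exact Finset.sum_congr rfl fun k _ => by rw [← hbeq k, smul_smul]
    rw [heq]
    have h := smul_mem_filTensor 𝔅 (pow_mul_mem_fil 𝔅 hU N 𝔅.one_mem_fil_zero) hsum
    rw [mul_one] at h
    have hidx : (0 : ℤ) + (N : ℕ) + (n + 1) = n + N + 1 := by ring
    rwa [hidx] at h
  have hall := core_aux 𝔅 ρ hU hχ hχ0 hloc hT0 hT1 heD hew hadapt (n + N) m hm _ b Finset.univ hb0
    (fun k hk => absurd (Finset.mem_univ k) hk) hsum' le_rfl
  intro k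
  have h1 : U ^ N * c k ∈ 𝔅.fil ((n + 1 - w k) + (N : ℕ)) := by
    rw [hbeq k]
    have h := pow_mul_mem_fil 𝔅 hU (m k) (hall k)
    have hidx : (1 : ℤ) + (m k : ℕ) = n + 1 - w k + (N : ℕ) := by have := hm k; omega
    rwa [hidx] at h
  exact mem_fil_of_pow_mul_mem 𝔅 hU N h1

end Core

end Literature.NumberTheory.PAdicHodge.TateGraded

end
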